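import Literature.NumberTheory.LFunctions.ProlateFrobeniusCertificate
import Literature.NumberTheory.ConnesConsani2021.ProlateProjections
import HarnessLib

/-!
# The printed table `λ(0), …, λ(5)` of Connes–Consani 2021 §4, certified in the kernel (signed)

LINE 1 — FRAMING: RH-FREE certified classical analysis (validated numerics for the even prolate
spheroidal wave functions at `c = 2π`); cell rh-crit, corpus C1 (Connes–Consani 2021), seat t3 (row =
CC2021 §4 first part, statement layer `ProlateProjections.lean`); bears_on: W-C/W-P (§4 FACT-LIST rows of
apex input (A); OFF the closing path of every route item).  WHAT THIS IS NOT: any claim about RH — nothing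
here bears on the truth of RH; a numerical table in a criterion paper is RH-FREE literature, and
certifying it fixes numbers, not RH.

Topic `NumberTheory/ConnesConsani2021`; namespace `Literature.NumberTheory.ConnesConsani2021` (checker
plumbing in the sub-namespace `LamCert`).  This module DISCHARGES the named fact

* `CC2021_sec4_lambda_numerics` (Connes–Consani 2021, §4 p. 16: "`λ(0) = 0.999971, λ(1) = −0.979485,
  λ(2) = 0.524086, λ(3) = −0.0589766, λ(4) = 0.00273233, λ(5) = −0.0000762914`", typed by seat t3 g1 as
  enclosures of one unit in the last printed digit of `prolateEigen n = (∫ h_{2n,1}) / h_{2n,1}(0)`),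

WITHOUT any numerical hypothesis: `CC2021_sec4_lambda_numerics_holds`.  It EXTENDS the tree's kernel
certificate machinery `Literature.NumberTheory.LFunctions.ProlateCert` (`ProlateFrobeniusCertificate.lean`,
seat cc-iso: Frobenius series at `x = 1` with a self-propagating geometric majorant, interval recursion
for the coefficients, certified shooting bracket `[blo, bhi]` of the eigen-parameter, certified zero count,
identification with the tree's unique prolate function) in two ways:

1. **Signed enclosures.**  The tree's `Cert.sound`/`Cert.enclosures` deliver `λ²` only; here
   `LamCert.lam_mem` delivers `λ = 2I₁u₀/u₀² ∈ [lo, hi]` itself (so the SIGNS `(−1)ⁿλ(n) > 0`, `n ≤ 5`,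
   are certified too — the `n ≤ 5` instances of clause 1 of the frozen fact `CC2021_sec4_lambda_basic`),
   re-deriving from an accepted certificate a parameter `b ∈ [blo, bhi]` (the tree's `Cert.sound`
   forgets the bracket) with `u_b′(0) = 0` and the certified zero count (`LamCert.exists_param_mem`).
2. **Bracket splitting.**  The naive interval extension of `χ ↦ (u_χ(0), ∫₀¹u_χ)` over the whole
   bracket loses a factor `≈ Σ_k |∂a_k/∂χ|` (`≈ 1.7·10³` at `χ₁₀ ≈ 130.24`), while the bracket itself
   cannot be narrower than the sign of `u′_χ(0)` can be certified at its ends (floor set by Mathlib's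
   20-digit `π`): for `λ(5)` (to be enclosed to `± 5.9·10⁻¹¹` absolute) the bracket `[blo, bhi]` is cut
   into `m` equal pieces and the `λ`-enclosure is checked on EVERY piece (`LamCert.piecesOK`; sound because
   `b` lies in one of them, `LamCert.exists_piece_mem`); the per-piece evaluation runs the coefficient
   recursion ONCE (`LamCert.lamIOfP`, proved equal to the tree's `u0I`/`i1I` combination,
   `LamCert.lamIOfP_eq`).

Certificates: the tree's `cert0 … cert3` (brackets of `χ₀, χ₂, χ₄, χ₆`; their `check`s are the tree
theorems `cert0_check … cert3_check`, not re-run) plus two NEW ones, `cert4` (`k = 4`, `χ₈(2π) =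
92.51701320838409718…`, bracket `± 5·10⁻¹³`, scale `2⁹⁶`, window `J = 48`) and `cert5` (`k = 5`,
`χ₁₀(2π) = 130.23891209826479195…`, bracket `± 2.5·10⁻¹³`, `2⁹⁶`, `J = 48`; `λ`-pieces `m = 50` at window
`40`).  The eigen-parameters were located by a 60-digit shooting computation of this seat and agree with the
rh-crit engine seat's 50-digit table (`cc/engine/step0`); the certificates themselves are checked by the
KERNEL (`decide +kernel`, standard axioms).  Certified (signed) enclosures:
`λ(0) ∈ [0.99997, 0.999972]`, `λ(1) ∈ [−0.979486, −0.979484]`, `λ(2) ∈ [0.524085, 0.524087]`,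
`λ(3) ∈ [−0.0589767, −0.0589765]`, `λ(4) ∈ [0.00273232, 0.00273234]`,
`λ(5) ∈ [−0.0000762915, −0.0000762913]` — exactly the printed windows (true values
`0.99997137…, −0.97948473…, 0.52408589…, −0.05897658…, 0.00273232874…, −0.0000762913592…`).

## References

* A. Connes, C. Consani, *Weil positivity and trace formula, the archimedean place*, Selecta Math. 27
  (2021) 77 = arXiv:2006.13771, §4 p. 16 (the list `λ(0), …, λ(5)`; arXiv chunk p0016:L22–L24).
  [ConnesConsani2021]
* D. Slepian, H. O. Pollak, *Prolate spheroidal wave functions, Fourier analysis and uncertainty — I*,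
  Bell System Tech. J. 40 (1961) 43–63, §III (the prolate equation, the eigenvalues of the finite Fourier
  transform). [SlepianPollak1961]
* E. A. Coddington, N. Levinson, *Theory of Ordinary Differential Equations* (1955), Ch. 4 §8 (Frobenius
  method at a regular singular point), Ch. 8 §2 (shooting). [CoddingtonLevinson1955]
* R. E. Moore, *Methods and Applications of Interval Analysis* (SIAM 1979), Sect. 2.2 (inclusion
  isotonicity, (2.16)–(2.21)); R. B. Kearfott, *Abstract generalized bisection and a cost bound*, Math.
  Comp. 49 (1987), Sect. 1 (bisection / sign certification). [Moore1979] [Kearfott1987]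
-/

noncomputable section

open Real Set Filter MeasureTheory intervalIntegral Finset
open scoped Topology BigOperators Interval

namespace Literature.NumberTheory.ConnesConsani2021

namespace LamCert

open Literature.Analysis.ValidatedNumerics Literature.Analysis.ValidatedNumerics.NumericsMP
  Literature.Analysis.ValidatedNumerics.PolyMP Literature.NumberTheory.LFunctions
  Literature.NumberTheory.LFunctions.ProlateCert

/-! ### Kernel side: one-pass signed `λ`-enclosure and bracket pieces -/

/-- The scaled majorant constant read off a PRECOMPUTED coefficient list `P = coeffsI S X (J+3)` (the
tree's `cmajS` recomputes the recursion three times). [cite: Moore1979, Sect. 2.2 (2.16)–(2.21)] -/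
def cmajP (P : IPoly) (J : ℕ) : ℤ :=
  max (max (Numerics.cdiv ((P.getD J ⟨0, 0⟩).absHi * 4 ^ J) (3 ^ J))
    (Numerics.cdiv ((P.getD (J + 1) ⟨0, 0⟩).absHi * 4 ^ (J + 1)) (3 ^ (J + 1))))
    (Numerics.cdiv ((P.getD (J + 2) ⟨0, 0⟩).absHi * 4 ^ (J + 2)) (3 ^ (J + 2)))

/-- The scaled value-tail radius from a precomputed coefficient list (cf. the tree's `rhoS`).
[cite: Moore1979, Sect. 2.2 (2.16)–(2.21)] -/
def rhoP (P : IPoly) (J : ℕ) : ℤ := Numerics.cdiv (cmajP P J * 4 * 3 ^ (J + 3)) (4 ^ (J + 3))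

/-- **One-pass signed enclosure of `λ = 2 I₁ u₀ / u₀²`** (`u₀ = u_χ(0)`, `I₁ = ∫₀¹ u_χ`) over a
parameter interval `X`, window `J`: the coefficient recursion is run once and the value at `t = 1`, the
moment and the tail radius are all read off the same list. [cite: Moore1979, Sect. 2.2 (2.16)–(2.21)] -/
def lamIOfP (S : ℕ) (X : MI) (J : ℕ) : Option MI :=
  let P := coeffsI S X (J + 3)
  let R := rhoP P J
  let U := hornerI S (widenHead R P) (MI.ofInt S 1)
  let I := (momI 0 P).widen R
  MI.divPos S ((MI.mul S I U).mulInt 2) (MI.sqr S U)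

/-- Left end of the `j`-th of `m` equal pieces of the bracket `[blo, bhi]`. [cite: Kearfott1987, Sect. 1] -/
def pieceLo (c : Cert) (m j : ℕ) : ℚ := c.blo + (c.bhi - c.blo) * j / m

/-- The `j`-th piece of the bracket as an interval. [cite: Kearfott1987, Sect. 1] -/
def piece (c : Cert) (m j : ℕ) : MI :=
  MI.span (ofRat c.S (pieceLo c m j)) (ofRat c.S (pieceLo c m (j + 1)))

/-- Check of the claimed signed enclosure `λ ∈ [lo, hi]` on the `j`-th piece. [cite: Moore1979, Sect. 2.2 (2.16)–(2.21)] -/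
def pieceOK (c : Cert) (J m : ℕ) (lo hi : ℚ) (j : ℕ) : Bool :=
  match lamIOfP c.S (piece c m j) J with
  | some L => qLeI c.S lo L && iLeQ c.S L hi
  | none => false

/-- **The signed-`λ` checker**: window `J` admissible for the majorant (`condQ`), `m ≥ 1` pieces, and the
enclosure holds on every piece. [cite: Kearfott1987, Sect. 1; Moore1979, Sect. 2.2 (2.16)–(2.21)] -/
def piecesOK (c : Cert) (J m : ℕ) (lo hi : ℚ) : Bool :=
  decide (0 < m) && condQ c.M J && (List.range m).all (pieceOK c J m lo hi)

/-! ### The one-pass enclosure equals the tree's `u0I`/`i1I` combination -/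

/-- `coeffsFrom` lists the third components of the successive triples (the tree's private lemma,
re-proved). [folklore] -/
private theorem coeffsFrom_eq' (S : ℕ) (X : MI) :
    ∀ n k : ℕ, coeffsFrom S X n k (tripleI S X k) = (List.range' k n).map fun j ↦ (tripleI S X j).2.2
  | 0, k => by simp [coeffsFrom]
  | n + 1, k => by
      have hsucc : tripleI S X (k + 1) = ((tripleI S X k).2.1, (tripleI S X k).2.2,
          stepI S X k (tripleI S X k).1 (tripleI S X k).2.1 (tripleI S X k).2.2) := by
        rw [tripleI]
      rw [List.range'_succ, List.map_cons, ← coeffsFrom_eq' S X n (k + 1), hsucc]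
      rfl

/-- `coeffsI S X N = [A_0, …, A_{N−1}]` as a mapped range. [folklore] -/
private theorem coeffsI_eq_map (S : ℕ) (X : MI) (N : ℕ) :
    coeffsI S X N = (List.range N).map fun j ↦ (tripleI S X j).2.2 := by
  rw [coeffsI, List.range_eq_range']
  exact coeffsFrom_eq' S X N 0

/-- The `j`-th entry of `coeffsI`. [folklore] -/
private theorem getD_coeffsI (S : ℕ) (X : MI) {N j : ℕ} (hj : j < N) (d : MI) :
    (coeffsI S X N).getD j d = (tripleI S X j).2.2 := by
  rw [coeffsI_eq_map, List.getD_eq_getElem?_getD, List.getElem?_map, List.getElem?_range hj]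
  rfl

/-- The one-pass majorant constant is the tree's `cmajS`. [folklore] -/
private theorem cmajP_eq (S : ℕ) (X : MI) (J : ℕ) : cmajP (coeffsI S X (J + 3)) J = cmajS S X J := by
  unfold cmajP cmajS
  rw [getD_coeffsI S X (by omega) _, getD_coeffsI S X (by omega) _, getD_coeffsI S X (by omega) _]

/-- **The one-pass signed enclosure is the tree's `2 I₁ u₀ / u₀²` combination.** [folklore] -/
private theorem lamIOfP_eq (S : ℕ) (X : MI) (J : ℕ) :
    lamIOfP S X J = MI.divPos S ((MI.mul S (i1I S X J) (u0I S X J)).mulInt 2) (MI.sqr S (u0I S X J)) := by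
  show MI.divPos S ((MI.mul S ((momI 0 (coeffsI S X (J + 3))).widen (rhoP (coeffsI S X (J + 3)) J))
      (hornerI S (widenHead (rhoP (coeffsI S X (J + 3)) J) (coeffsI S X (J + 3))) (MI.ofInt S 1))).mulInt 2)
      (MI.sqr S (hornerI S (widenHead (rhoP (coeffsI S X (J + 3)) J) (coeffsI S X (J + 3)))
        (MI.ofInt S 1))) = _
  have hr : rhoP (coeffsI S X (J + 3)) J = rhoS S X J := by
    unfold rhoP rhoS
    rw [cmajP_eq]
  rw [hr]
  rfl

/-! ### Soundness -/

/-- A value of `bsgn` is `1`, `−1` or `0` (the tree's private lemma, re-proved). [folklore] -/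
private theorem bsgn_cases' (S : ℕ) (X : MI) (J : ℕ) :
    bsgn S X J = 1 ∨ bsgn S X J = -1 ∨ bsgn S X J = 0 := by
  unfold bsgn; dsimp only; split_ifs <;> simp

/-- `k ≤ N(blo)` from `lowOK` (the tree's private lemma, re-proved). [folklore] -/
private theorem k_le_frobZeros_of_lowOK' {c : Cert} (hS : 0 < c.S) {M : ℝ}
    (hM : |4 * π ^ 2 - (c.blo : ℝ)| ≤ M) (hcond : Cond M (3 / 4) c.J) (h : c.lowOK = true) :
    c.k ≤ frobZeros 1 (c.blo : ℝ) := by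
  unfold Cert.lowOK at h
  cases hp : c.pts with
  | nil => simp [hp] at h; rw [h]; exact Nat.zero_le _
  | cons x rest =>
      simp only [hp, Bool.and_eq_true, decide_eq_true_eq] at h
      obtain ⟨halt, hlen⟩ := h
      rw [← hlen]
      exact le_frobZeros_of_altOK hS (mem_ofRat c.S c.blo) hM hcond halt

/-- **An accepted certificate pins a parameter `b` IN ITS BRACKET** with `u_b′(0) = 0` and exactly
`k` zeros of `u_b` in `(0, 1)` (the first half of the tree's `Cert.sound`, which forgets `b ∈ [blo, bhi]`).
[cite: CoddingtonLevinson1955, Ch. 8 §2 Thm 2.1; Kearfott1987, Sect. 1] -/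
theorem exists_param_mem (c : Cert) (h : c.check = true) :
    ∃ b : ℝ, (c.blo : ℝ) ≤ b ∧ b ≤ c.bhi ∧ frobSol₁ 1 b 0 = 0 ∧ frobZeros 1 b = c.k := by
  unfold Cert.check at h
  simp only [Bool.and_eq_true, decide_eq_true_eq, beq_iff_eq] at h
  obtain ⟨⟨⟨⟨⟨⟨⟨⟨⟨hS, hle⟩, hMok⟩, hcQ⟩, hsgn⟩, hlow⟩, hcells⟩, hmono⟩, -⟩, -⟩ := h
  have hcond : Cond (c.M : ℝ) (3 / 4) c.J := cond_of_condQ hcQ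
  have hmlo : MI.mem c.S (c.blo : ℝ) c.Xlo := mem_ofRat c.S c.blo
  have hmhi : MI.mem c.S (c.bhi : ℝ) c.Xhi := mem_ofRat c.S c.bhi
  have hleR : (c.blo : ℝ) ≤ c.bhi := by exact_mod_cast hle
  have hMlo : |4 * π ^ 2 - (c.blo : ℝ)| ≤ (c.M : ℝ) := abs_le_of_mOK hMok le_rfl hleR
  have hMhi : |4 * π ^ 2 - (c.bhi : ℝ)| ≤ (c.M : ℝ) := abs_le_of_mOK hMok hleR le_rfl
  have hcontB : ContinuousOn (fun χ ↦ frobSol₁ 1 χ 0) (Icc (c.blo : ℝ) c.bhi) :=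
    (continuous_frobSol₁_zero one_pos).continuousOn
  have hB : ∃ b ∈ Icc (c.blo : ℝ) c.bhi, frobSol₁ 1 b 0 = 0 := by
    rcases bsgn_cases' c.S c.Xlo c.J with h1 | h1 | h1 <;>
      rcases bsgn_cases' c.S c.Xhi c.J with h2 | h2 | h2 <;>
      simp only [h1, h2] at hsgn <;> norm_num at hsgn
    · have hp := frobSol₁_zero_pos_of_bsgn hS hmlo hMlo hcond h1
      have hn := frobSol₁_zero_neg_of_bsgn hS hmhi hMhi hcond h2
      obtain ⟨b, hb, hb0⟩ := intermediate_value_Icc' hleR hcontB ⟨hn.le, hp.le⟩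
      exact ⟨b, hb, hb0⟩
    · have hn := frobSol₁_zero_neg_of_bsgn hS hmlo hMlo hcond h1
      have hp := frobSol₁_zero_pos_of_bsgn hS hmhi hMhi hcond h2
      obtain ⟨b, hb, hb0⟩ := intermediate_value_Icc hleR hcontB ⟨hn.le, hp.le⟩
      exact ⟨b, hb, hb0⟩
  obtain ⟨b, hb, hb0⟩ := hB
  have hN : frobZeros 1 b = c.k := by
    have h1 : c.k ≤ frobZeros 1 (c.blo : ℝ) := k_le_frobZeros_of_lowOK' hS hMlo hcond hlow
    have h2 : frobZeros 1 (c.blo : ℝ) ≤ frobZeros 1 b := frobZeros_mono one_pos hb.1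
    have h3 : frobZeros 1 b ≤ frobZeros 1 (c.bhi : ℝ) := frobZeros_mono one_pos hb.2
    have h4 : frobZeros 1 (c.bhi : ℝ) ≤ monoCount c.cells :=
      frobZeros_le_of_cellsOK hS hmhi hMhi hcond hcells
    omega
  exact ⟨b, hb.1, hb.2, hb0, hN⟩

/-- Every point of `[lo, hi]` lies in one of `m ≥ 1` equal closed pieces. [folklore] -/
private theorem exists_piece_mem {lo hi b : ℝ} {m : ℕ} (hm : 0 < m) (h1 : lo ≤ b) (h2 : b ≤ hi) :
    ∃ j : ℕ, j < m ∧ lo + (hi - lo) * j / m ≤ b ∧ b ≤ lo + (hi - lo) * (j + 1) / m := by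
  have hmR : (0 : ℝ) < m := by exact_mod_cast hm
  rcases eq_or_lt_of_le (sub_nonneg.mpr (h1.trans h2)) with hW | hW
  · -- degenerate bracket
    refine ⟨0, hm, ?_, ?_⟩
    · simp; exact h1
    · have : hi = lo := by linarith
      subst this
      simp
      exact h2
  · set W := hi - lo with hWdef
    set s : ℝ := (b - lo) / W * m with hsdef
    have hs0 : 0 ≤ s := by positivity
    have hsm : s ≤ m := by
      rw [hsdef, div_mul_eq_mul_div, div_le_iff₀ hW]
      nlinarith
    set j := min ⌊s⌋₊ (m - 1) with hjdef
    have hjs : (j : ℝ) ≤ s := by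
      have : (j : ℝ) ≤ (⌊s⌋₊ : ℕ) := by exact_mod_cast min_le_left _ _
      exact this.trans (Nat.floor_le hs0)
    have hsj : s ≤ j + 1 := by
      rcases le_total ⌊s⌋₊ (m - 1) with hle | hle
      · have hj : j = ⌊s⌋₊ := min_eq_left hle
        rw [hj]
        exact (Nat.lt_floor_add_one s).le
      · have hj : j = m - 1 := min_eq_right hle
        rw [hj]
        have : ((m - 1 : ℕ) : ℝ) + 1 = m := by
          rw [Nat.cast_sub (by omega)]; push_cast; ring
        rw [this]; exact hsm
    refine ⟨j, ?_, ?_, ?_⟩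
    · have : j ≤ m - 1 := min_le_right _ _
      omega
    · have e : lo + W * j / m ≤ lo + W * s / m := by gcongr
      have e2 : lo + W * s / m = b := by
        rw [hsdef]; field_simp; ring
      linarith
    · have e : lo + W * s / m ≤ lo + W * (j + 1) / m := by gcongr
      have e2 : lo + W * s / m = b := by
        rw [hsdef]; field_simp; ring
      linarith

/-- **Soundness of the signed checker (prolate form).**  For the unique prolate function `f` with `2k`
zeros (`λ = 1`, `c = 2π`, tree interface `IsProlateFunction 1 (2k) f`): an accepted certificate `c`
together with an accepted `piecesOK c J m lo hi` proves `lo ≤ (∫ f)/f(0) ≤ hi` — a SIGNED enclosure of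
the eigenvalue `λ` of the finite cosine transform on `f`.
[cite: SlepianPollak1961, §III; CoddingtonLevinson1955, Ch. 8 §2 Thm 2.1; Moore1979, Sect. 2.2 (2.16)–(2.21)] -/
theorem lam_mem (c : Cert) {J m : ℕ} {lo hi : ℚ} (hc : c.check = true) (hp : piecesOK c J m lo hi = true)
    {f : ℝ → ℝ} (hf : IsProlateFunction 1 (2 * c.k) f) :
    (lo : ℝ) ≤ (∫ x, f x) / f 0 ∧ (∫ x, f x) / f 0 ≤ hi := by
  obtain ⟨b, hb1, hb2, hb0, hN⟩ := exists_param_mem c hc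
  have hc' := hc
  unfold Cert.check at hc'
  simp only [Bool.and_eq_true, decide_eq_true_eq, beq_iff_eq] at hc'
  obtain ⟨⟨⟨⟨⟨⟨⟨⟨⟨hS, hle⟩, hMok⟩, -⟩, -⟩, -⟩, -⟩, -⟩, -⟩, -⟩ := hc'
  unfold piecesOK at hp
  simp only [Bool.and_eq_true, decide_eq_true_eq] at hp
  obtain ⟨⟨hm, hcQ⟩, hall⟩ := hp
  have hcond : Cond (c.M : ℝ) (3 / 4) J := cond_of_condQ hcQ
  have hMb : |4 * π ^ 2 - b| ≤ (c.M : ℝ) := abs_le_of_mOK hMok hb1 hb2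
  -- the piece containing `b`
  obtain ⟨j, hjm, hj1, hj2⟩ := exists_piece_mem hm hb1 hb2
  have hpj : pieceOK c J m lo hi j = true :=
    List.all_eq_true.mp hall j (List.mem_range.mpr hjm)
  have hlo' : ((pieceLo c m j : ℚ) : ℝ) ≤ b := by
    unfold pieceLo; push_cast; exact hj1
  have hhi' : b ≤ ((pieceLo c m (j + 1) : ℚ) : ℝ) := by
    unfold pieceLo; push_cast; exact hj2
  have hbX : MI.mem c.S b (piece c m j) :=
    MI.mem_span (mem_ofRat c.S _) (mem_ofRat c.S _) hlo' hhi'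
  -- the enclosures at `χ = b`
  have hu0 := mem_u0I hS hbX hMb hcond
  have hi1 := mem_i1I hS hbX hMb hcond
  obtain ⟨hC, hf0, hint⟩ := values_of_frob hb0 hN hf
  set u0 := frobSol 1 b 0 with hu0def
  set I1 := ∫ x in (0:ℝ)..1, frobSol 1 b x with hI1def
  have hu0sq : MI.mem c.S (u0 ^ 2) (MI.sqr c.S (u0I c.S (piece c m j) J)) := MI.mem_sqr hS hu0
  have hnum : MI.mem c.S (I1 * u0 * (2 : ℤ))
      ((MI.mul c.S (i1I c.S (piece c m j) J) (u0I c.S (piece c m j) J)).mulInt 2) :=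
    MI.mem_mulInt (MI.mem_mul hS hi1 hu0) 2
  unfold pieceOK at hpj
  rw [lamIOfP_eq] at hpj
  cases hL : MI.divPos c.S ((MI.mul c.S (i1I c.S (piece c m j) J) (u0I c.S (piece c m j) J)).mulInt 2)
      (MI.sqr c.S (u0I c.S (piece c m j) J)) with
  | none => simp [hL] at hpj
  | some L =>
    simp only [hL, Bool.and_eq_true] at hpj
    obtain ⟨e1, e2⟩ := hpj
    have hLpos : 0 < (MI.sqr c.S (u0I c.S (piece c m j) J)).lo := by
      by_contra hlo
      unfold MI.divPos at hL
      rw [if_neg hlo] at hL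
      exact absurd hL (by simp)
    have hU0pos : 0 < u0 ^ 2 := MI.pos_of_lo_pos hu0sq hLpos
    have hu0ne : u0 ≠ 0 := by
      intro h0; rw [h0] at hU0pos; norm_num at hU0pos
    have hf1 : f 1 ≠ 0 := by
      intro h0; rw [h0] at hC; norm_num at hC
    have hmem := MI.mem_divPos hS hL hnum hu0sq
    have hlam : (∫ x, f x) / f 0 = I1 * u0 * ((2 : ℤ) : ℝ) / u0 ^ 2 := by
      rw [hint, hf0]
      push_cast
      field_simp
    rw [hlam]
    exact ⟨le_of_qLeI e1 hmem hS, le_of_iLeQ e2 hmem hS⟩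

end LamCert

open LamCert Literature.NumberTheory.LFunctions Literature.NumberTheory.LFunctions.ProlateCert
  Literature.Analysis.ValidatedNumerics.NumericsMP

/-! ### The two new certificates (`k = 4, 5`) and the kernel checks -/

/-- Certificate data for `k = 4` (the even prolate function with `8` zeros; bracket `± 5·10⁻¹³` of
`χ₈(2π) = 92.51701320838409718073…`, scale `2⁹⁶`, window `J = 48`; the `λ²/t` claims are deliberately
trivial — the content is carried by the signed check below). [cite: ConnesConsani2021, §4 p. 16 (λ(4)); CoddingtonLevinson1955, Ch. 8 §2 Thm 2.1] -/
def cert4 : Cert where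
  S := 79228162514264337593543950336
  J := 48
  d := 12
  M := 54
  k := 4
  blo := (92.5170132083835972 : ℚ)
  bhi := (92.5170132083845972 : ℚ)
  pts := [(0 : ℚ), (0.32 : ℚ), (0.61 : ℚ), (0.85 : ℚ), (0.97 : ℚ)]
  cells := [((0.02 : ℚ), false, true), ((0.10 : ℚ), true, true), ((0.16 : ℚ), false, false),
    ((0.21 : ℚ), false, false), ((0.34 : ℚ), true, false), ((0.40 : ℚ), false, true),
    ((0.46 : ℚ), false, true), ((0.64 : ℚ), true, true), ((0.70 : ℚ), false, false),
    ((0.76 : ℚ), false, false), ((0.95 : ℚ), true, false), ((1 : ℚ), false, true)]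
  lam2lo := 0
  lam2hi := 1
  lp2lo := 0
  tlo := 0
  thi := 1000

/-- Certificate data for `k = 5` (`10` zeros; bracket `± 2.5·10⁻¹³` of
`χ₁₀(2π) = 130.23891209826479195634…`, scale `2⁹⁶`, window `J = 48`). [cite: ConnesConsani2021, §4 p. 16 (λ(5)); CoddingtonLevinson1955, Ch. 8 §2 Thm 2.1] -/
def cert5 : Cert where
  S := 79228162514264337593543950336
  J := 48
  d := 12
  M := 91
  k := 5
  blo := (130.23891209826454196 : ℚ)
  bhi := (130.23891209826504196 : ℚ)
  pts := [(0 : ℚ), (0.27 : ℚ), (0.52 : ℚ), (0.75 : ℚ), (0.90 : ℚ), (0.985 : ℚ)]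
  cells := [((0.012 : ℚ), false, true), ((0.058 : ℚ), true, true), ((0.10 : ℚ), false, false),
    ((0.125 : ℚ), false, false), ((0.22 : ℚ), true, false), ((0.27 : ℚ), false, true),
    ((0.31 : ℚ), false, true), ((0.44 : ℚ), true, true), ((0.50 : ℚ), false, false),
    ((0.545 : ℚ), false, false), ((0.70 : ℚ), true, false), ((0.75 : ℚ), false, true),
    ((0.80 : ℚ), false, true), ((0.97 : ℚ), true, true), ((1 : ℚ), false, false)]
  lam2lo := 0
  lam2hi := 1
  lp2lo := 0
  tlo := 0
  thi := 1000

/-- **Kernel evaluation of the certificate for `k = 4`** (bracket, sign change of `u′_χ(0)`, four sign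
alternations of `u_{blo}`, cell partition of `u_{bhi}` with four monotone cells). [cite: ConnesConsani2021, §4 p. 16 (λ(4))] -/
theorem cert4_check : cert4.check = true := by
  decide +kernel

/-- **Kernel evaluation of the certificate for `k = 5`.** [cite: ConnesConsani2021, §4 p. 16 (λ(5))] -/
theorem cert5_check : cert5.check = true := by
  decide +kernel

/-- Kernel check of the signed enclosure `λ(0) ∈ [0.99997, 0.999972]` on the tree's `cert0` bracket. [cite: ConnesConsani2021, §4 p. 16 (λ(0))] -/
theorem cert0_pieces : piecesOK cert0 38 1 (0.99997 : ℚ) (0.999972 : ℚ) = true := by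
  decide +kernel

/-- Kernel check of the signed enclosure `λ(1) ∈ [−0.979486, −0.979484]` on the tree's `cert1` bracket. [cite: ConnesConsani2021, §4 p. 16 (λ(1))] -/
theorem cert1_pieces : piecesOK cert1 38 1 (-0.979486 : ℚ) (-0.979484 : ℚ) = true := by
  decide +kernel

/-- Kernel check of the signed enclosure `λ(2) ∈ [0.524085, 0.524087]` on the tree's `cert2` bracket. [cite: ConnesConsani2021, §4 p. 16 (λ(2))] -/
theorem cert2_pieces : piecesOK cert2 38 1 (0.524085 : ℚ) (0.524087 : ℚ) = true := by
  decide +kernel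

/-- Kernel check of the signed enclosure `λ(3) ∈ [−0.0589767, −0.0589765]` on the tree's `cert3` bracket. [cite: ConnesConsani2021, §4 p. 16 (λ(3))] -/
theorem cert3_pieces : piecesOK cert3 38 1 (-0.0589767 : ℚ) (-0.0589765 : ℚ) = true := by
  decide +kernel

/-- Kernel check of the signed enclosure `λ(4) ∈ [0.00273232, 0.00273234]` (one piece, window `40`). [cite: ConnesConsani2021, §4 p. 16 (λ(4))] -/
theorem cert4_pieces : piecesOK cert4 40 1 (0.00273232 : ℚ) (0.00273234 : ℚ) = true := by
  decide +kernel

/-- Kernel check of the signed enclosure `λ(5) ∈ [−0.0000762915, −0.0000762913]` (`50` pieces of the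
bracket, window `40`). [cite: ConnesConsani2021, §4 p. 16 (λ(5))] -/
theorem cert5_pieces : piecesOK cert5 40 50 (-0.0000762915 : ℚ) (-0.0000762913 : ℚ) = true := by
  decide +kernel

/-! ### Signed enclosures of `λ(0), …, λ(5)` and the discharge -/

/-- `λ(0) ∈ [0.99997, 0.999972]` (printed `0.999971`). [cite: ConnesConsani2021, §4 p. 16 (arXiv p0016:L22–L24); SlepianPollak1961, §III] -/
theorem prolateEigen_zero_mem_Icc : (0.99997 : ℝ) ≤ prolateEigen 0 ∧ prolateEigen 0 ≤ 0.999972 := by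
  have h := lam_mem cert0 cert0_check cert0_pieces (isProlateFunction_prolateFun 0)
  unfold prolateEigen
  norm_num at h ⊢
  exact h

/-- `λ(1) ∈ [−0.979486, −0.979484]` (printed `−0.979485`). [cite: ConnesConsani2021, §4 p. 16 (arXiv p0016:L22–L24); SlepianPollak1961, §III] -/
theorem prolateEigen_one_mem_Icc : (-0.979486 : ℝ) ≤ prolateEigen 1 ∧ prolateEigen 1 ≤ -0.979484 := by
  have h := lam_mem cert1 cert1_check cert1_pieces (isProlateFunction_prolateFun 1)
  unfold prolateEigen
  norm_num at h ⊢
  exact h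

/-- `λ(2) ∈ [0.524085, 0.524087]` (printed `0.524086`). [cite: ConnesConsani2021, §4 p. 16 (arXiv p0016:L22–L24); SlepianPollak1961, §III] -/
theorem prolateEigen_two_mem_Icc : (0.524085 : ℝ) ≤ prolateEigen 2 ∧ prolateEigen 2 ≤ 0.524087 := by
  have h := lam_mem cert2 cert2_check cert2_pieces (isProlateFunction_prolateFun 2)
  unfold prolateEigen
  norm_num at h ⊢
  exact h

/-- `λ(3) ∈ [−0.0589767, −0.0589765]` (printed `−0.0589766`). [cite: ConnesConsani2021, §4 p. 16 (arXiv p0016:L22–L24); SlepianPollak1961, §III] -/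
theorem prolateEigen_three_mem_Icc :
    (-0.0589767 : ℝ) ≤ prolateEigen 3 ∧ prolateEigen 3 ≤ -0.0589765 := by
  have h := lam_mem cert3 cert3_check cert3_pieces (isProlateFunction_prolateFun 3)
  unfold prolateEigen
  norm_num at h ⊢
  exact h

/-- `λ(4) ∈ [0.00273232, 0.00273234]` (printed `0.00273233`). [cite: ConnesConsani2021, §4 p. 16 (arXiv p0016:L22–L24); SlepianPollak1961, §III] -/
theorem prolateEigen_four_mem_Icc :
    (0.00273232 : ℝ) ≤ prolateEigen 4 ∧ prolateEigen 4 ≤ 0.00273234 := by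
  have h := lam_mem cert4 cert4_check cert4_pieces (isProlateFunction_prolateFun 4)
  unfold prolateEigen
  norm_num at h ⊢
  exact h

/-- `λ(5) ∈ [−0.0000762915, −0.0000762913]` (printed `−0.0000762914`). [cite: ConnesConsani2021, §4 p. 16 (arXiv p0016:L22–L24); SlepianPollak1961, §III] -/
theorem prolateEigen_five_mem_Icc :
    (-0.0000762915 : ℝ) ≤ prolateEigen 5 ∧ prolateEigen 5 ≤ -0.0000762913 := by
  have h := lam_mem cert5 cert5_check cert5_pieces (isProlateFunction_prolateFun 5)
  unfold prolateEigen
  norm_num at h ⊢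
  exact h

/-- **The signs `(−1)ⁿ λ(n) > 0` for `n ≤ 5`** — the instances `n ≤ 5` of clause 1 of the named fact
`CC2021_sec4_lambda_basic` ("the sign of `λ(n)` is `(−1)ⁿ`", Rokhlin–Xiao 2007 Thm. 3 at even index),
here CERTIFIED from the signed enclosures (the all-`n` statement is not claimed).
[cite: ConnesConsani2021, §4 p. 16 (arXiv p0016:L22–L25); RokhlinXiao2007, Thm. 3 p. 109] -/
theorem neg_one_pow_mul_prolateEigen_pos_of_le_five {n : ℕ} (hn : n ≤ 5) :
    0 < (-1 : ℝ) ^ n * prolateEigen n := by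
  obtain ⟨a0, b0⟩ := prolateEigen_zero_mem_Icc
  obtain ⟨a1, b1⟩ := prolateEigen_one_mem_Icc
  obtain ⟨a2, b2⟩ := prolateEigen_two_mem_Icc
  obtain ⟨a3, b3⟩ := prolateEigen_three_mem_Icc
  obtain ⟨a4, b4⟩ := prolateEigen_four_mem_Icc
  obtain ⟨a5, b5⟩ := prolateEigen_five_mem_Icc
  interval_cases n <;> norm_num <;> linarith

/-- **DISCHARGE of `CC2021_sec4_lambda_numerics`**: the printed table `λ(0) = 0.999971, λ(1) = −0.979485,
λ(2) = 0.524086, λ(3) = −0.0589766, λ(4) = 0.00273233, λ(5) = −0.0000762914` of Connes–Consani 2021 §4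
holds as typed (each value to one unit in its last printed digit), certified in the kernel — signs
included — by Frobenius-series certificates; no numerical hypothesis.  RH-FREE.
[cite: ConnesConsani2021, §4 p. 16 (arXiv p0016:L22–L24); SlepianPollak1961, §III] -/
theorem CC2021_sec4_lambda_numerics_holds : CC2021_sec4_lambda_numerics := by
  obtain ⟨a0, b0⟩ := prolateEigen_zero_mem_Icc
  obtain ⟨a1, b1⟩ := prolateEigen_one_mem_Icc
  obtain ⟨a2, b2⟩ := prolateEigen_two_mem_Icc
  obtain ⟨a3, b3⟩ := prolateEigen_three_mem_Icc
  obtain ⟨a4, b4⟩ := prolateEigen_four_mem_Icc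
  obtain ⟨a5, b5⟩ := prolateEigen_five_mem_Icc
  unfold CC2021_sec4_lambda_numerics
  refine ⟨?_, ?_, ?_, ?_, ?_, ?_⟩ <;> rw [abs_le] <;> constructor <;> norm_num <;> linarith

end Literature.NumberTheory.ConnesConsani2021

end
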